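import Mathlib
import Literature.AlgebraicGeometry.Resolution.CobordantBlowupRegular
import Literature.AlgebraicGeometry.Resolution.CobordantBlowupRegularCentre
import Literature.AlgebraicGeometry.Resolution.WeightedMonomialQuasiRegular

/-!
# S1a, helper H3a: the weighted extended Rees algebra of a K1′-regular sequence is REGULAR

(crux stmt-ResolutionOfSingularities-15640 `WildQuotients.WildQuotientResolution`, S1 = stmt-…-17941
`CyclicQuotientFourfolds`, S1a cut, stub `stub_localGameT` — res-L1-w45c-plan-1 ASSIGN 2026-08-27T20:16:49Z
«stub-1 TAKES H3a = `reesAlgebra_quotTInv_equiv_weightedGr` + `reesAlgebra_isRegularRing`», the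
LOAD-BEARING input of res-L1-w45c-idea-2's one-node producer step H3 (`h123/S1aProducerStep.lean`).
[OURS · L1 W4.5c] — ASSEMBLY of Literature decls; NOT a statement of any manuscript; AI-produced.
Prover res-L1-w45c-stub-1.)

PRESEARCH (`## Census` / STATUS 20:24:32Z): idea-2's `reesAlgebra f w := B[T⁻¹, f_i T^{w_i}] ⊆ B[T;T⁻¹]`
IS Literature's `cobordantAlgebra f w` (Włodarczyk's full cobordant blow-up algebra,
`CobordantBlowupAlgebra.lean`, same `Algebra.adjoin` literally), `tInv = cobordantAlgebra.s`,
`gen = cobordantAlgebra.u'`; and the tree PROVES `cobordantAlgebra.isRegularRing` [Włodarczyk2022, §2.3.9]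
and the exceptional-fibre isomorphism `cobordantAlgebra.nonempty_quotient_span_s_equiv`
(`R^w ⧸ (t⁻¹) ≃ (B ⧸ (f))[X]`), both GIVEN the WEIGHTED QUASI-REGULARITY of the centre; the engine
`coeff_mem_span_of_isWeightedHomogeneous` derives it from a PERMUTABLE regular family, and
`weightedQuasiRegular_of_localization` globalises. The one genuinely new step here: a K1′-regular
SEQUENCE (`RingTheory.Sequence.IsWeaklyRegular B (List.ofFn f)`) is, locally at every maximal ideal
containing it, a permutable regular family (Mathlib `IsWeaklyRegular.of_isLocalization`,
`IsWeaklyRegular.of_perm_of_subset_jacobson_annihilator`), hence weighted quasi-regular.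

* `mem_span_image_of_mul_mem_of_isWeaklyRegular_of_mem_maximalIdeal` — in a Noetherian local ring,
  a weakly regular sequence `x` in `𝔪` is a permutable family: `xᵢ y ∈ (x_t : t ∈ T)`, `i ∉ T` ⇒
  `y ∈ (x_t : t ∈ T)`;
* `weightedQuasiRegular_of_isWeaklyRegular_of_mem_maximalIdeal` — hence weighted quasi-regular (local);
* `weightedQuasiRegular_of_isWeaklyRegular` — weighted quasi-regularity of a weakly regular sequence
  in a Noetherian ring (local-to-global);
* **`cobordantAlgebra_isRegularRing_of_isWeaklyRegular`** — H3a: `B` regular, `0 < wᵢ`,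
  `f` weakly regular with `B ⧸ (f)` regular ⇒ `B[t⁻¹, fᵢ t^{wᵢ}]` Noetherian and REGULAR;
  `nonempty_cobordantAlgebra_quotient_s_equiv_of_isWeaklyRegular` — and `R^w ⧸ (t⁻¹) ≃ (B ⧸ (f))[X₁,…,X_c]`
  (plan-1's `reesAlgebra_quotTInv_equiv_weightedGr`); `…_of_isRegular` — the same from
  `RingTheory.Sequence.IsRegular` (K1′ letter).
-/

-- single-problem summit: the doubled namespace component `ResolutionOfSingularities` is forced
set_option linter.dupNamespace false

noncomputable section

open MvPolynomial IsLocalRing RingTheory.Sequence Literature.AlgebraicGeometry.Resolution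

namespace Summit.ResolutionOfSingularities.ResolutionOfSingularities.Theorems.WildQuotientResolution.S1

universe u

/-! ## A weakly regular sequence in the maximal ideal of a Noetherian local ring is a permutable family -/

/-- **Permutability, as used by the weighted quasi-regularity engine**: in a Noetherian local ring `R`,
if `x₁, …, x_k ∈ 𝔪` is a weakly regular sequence then for every `T ⊆ {1..k}` and `i ∉ T`,
`xᵢ · y ∈ (x_t : t ∈ T)` forces `y ∈ (x_t : t ∈ T)` (permute `T` to the front followed by `xᵢ` —
Mathlib `IsWeaklyRegular.of_perm_of_subset_jacobson_annihilator` — and read off the regularity of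
`xᵢ` on `R ⧸ (x_T)`). [cite: Matsumura1987, Thm. 16.3 / Cor.] -/
theorem mem_span_image_of_mul_mem_of_isWeaklyRegular_of_mem_maximalIdeal {R : Type u} [CommRing R]
    [IsLocalRing R] [IsNoetherianRing R] {k : ℕ} (x : Fin k → R)
    (hx : IsWeaklyRegular R (List.ofFn x)) (hm : ∀ i, x i ∈ maximalIdeal R)
    (i : Fin k) (T : Set (Fin k)) (hiT : i ∉ T) (y : R)
    (hy : x i * y ∈ Ideal.span (x '' T)) : y ∈ Ideal.span (x '' T) := by
  classical
  -- the index permutation: `T` first, then `i`, then the rest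
  set lT : List (Fin k) := (List.finRange k).filter (fun j => decide (j ∈ T)) with hlT
  set lC : List (Fin k) := (List.finRange k).filter (fun j => !decide (j ∈ T)) with hlC
  have hperm₁ : List.Perm (lT ++ lC) (List.finRange k) :=
    List.filter_append_perm (fun j => decide (j ∈ T)) (List.finRange k)
  have hiC : i ∈ lC := by
    rw [hlC, List.mem_filter]
    exact ⟨List.mem_finRange i, by simp [hiT]⟩
  have hperm₂ : List.Perm lC (i :: lC.erase i) := List.perm_cons_erase hiC
  have hperm : List.Perm (List.ofFn x) ((lT.map x) ++ (x i :: (lC.erase i).map x)) := by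
    rw [List.ofFn_eq_map]
    have h : List.Perm (List.finRange k) (lT ++ (i :: lC.erase i)) :=
      hperm₁.symm.trans (List.Perm.append_left lT hperm₂)
    simpa [List.map_append] using h.map x
  -- the permuted sequence is weakly regular (all members lie in the Jacobson radical `𝔪`)
  have hjac : ∀ r ∈ List.ofFn x, r ∈ (Module.annihilator R R).jacobson := by
    intro r hr
    rw [List.mem_ofFn] at hr
    obtain ⟨j, rfl⟩ := hr
    refine Ideal.jacobson_mono bot_le ?_
    rw [IsLocalRing.jacobson_eq_maximalIdeal ⊥ bot_ne_top]
    exact hm j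
  have hx' := hx.of_perm_of_subset_jacobson_annihilator hperm hjac
  -- regularity of `x i` on `R ⧸ (x_T)`
  have h2 := ((isWeaklyRegular_append_iff R (lT.map x) (x i :: (lC.erase i).map x)).mp hx').2
  have h3 := ((isWeaklyRegular_cons_iff _ (x i) ((lC.erase i).map x)).mp h2).1
  -- `Ideal.ofList (lT.map x) = (x_t : t ∈ T)`
  have hI : Ideal.ofList (lT.map x) = Ideal.span (x '' T) := by
    change Ideal.span {r | r ∈ lT.map x} = _
    congr 1
    ext r
    simp only [Set.mem_setOf_eq, List.mem_map, Set.mem_image, hlT, List.mem_filter, List.mem_finRange,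
      true_and, decide_eq_true_eq]
  have hIT : (Ideal.ofList (lT.map x) • (⊤ : Submodule R R)) = (Ideal.span (x '' T)).restrictScalars R := by
    rw [hI, Ideal.smul_eq_mul, Ideal.mul_top]
    rfl
  -- conclude
  have hzero : (Submodule.Quotient.mk (p := Ideal.ofList (lT.map x) • (⊤ : Submodule R R)) y) = 0 := by
    refine h3 (show x i • Submodule.Quotient.mk y =
      x i • (0 : R ⧸ (Ideal.ofList (lT.map x) • (⊤ : Submodule R R))) from ?_)
    rw [smul_zero, ← Submodule.Quotient.mk_smul, Submodule.Quotient.mk_eq_zero, hIT, smul_eq_mul]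
    exact hy
  rw [Submodule.Quotient.mk_eq_zero, hIT] at hzero
  exact hzero

/-- **Weighted quasi-regularity of a weakly regular sequence in a Noetherian local ring**: for
`x₁, …, x_k ∈ 𝔪` weakly regular and positive weights, a `w`-form `P` of weight `n` with
`P(x) ∈ 𝒥ₙ₊₁` has all its coefficients in `(x)`. (`coeff_mem_span_of_isWeightedHomogeneous` with the
permutability above.) [cite: Matsumura1987, Thm. 16.2] [cite: Wlodarczyk2022, §2.3.9] -/
theorem weightedQuasiRegular_of_isWeaklyRegular_of_mem_maximalIdeal {R : Type u} [CommRing R]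
    [IsLocalRing R] [IsNoetherianRing R] {k : ℕ} (x : Fin k → R) (w : Fin k → ℕ) (hw : ∀ i, 0 < w i)
    (hx : IsWeaklyRegular R (List.ofFn x)) (hm : ∀ i, x i ∈ maximalIdeal R)
    (n : ℕ) (P : MvPolynomial (Fin k) R) (hP : P.IsWeightedHomogeneous w n)
    (heval : MvPolynomial.eval x P ∈ (weightedFiltration x w).ideal (n + 1)) (β : Fin k →₀ ℕ) :
    P.coeff β ∈ Ideal.span (Set.range x) := by
  classical
  have hperm : ∀ i ∈ (Finset.univ : Finset (Fin k)), ∀ T : Set (Fin k),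
      T ⊆ ↑(Finset.univ : Finset (Fin k)) → i ∉ T → ∀ y : R,
        x i * y ∈ Ideal.span (x '' T) → y ∈ Ideal.span (x '' T) :=
    fun i _ T _ hiT y hy =>
      mem_span_image_of_mul_mem_of_isWeaklyRegular_of_mem_maximalIdeal x hx hm i T hiT y hy
  have key := coeff_mem_span_of_isWeightedHomogeneous x w Finset.univ (fun i _ => hw i) hperm hP
    (fun β _ => by simp) ?_ β
  · simpa [Set.image_univ] using key
  · rw [weightedFiltration_ideal] at heval
    refine (show Ideal.span (weightedMonomials x w (n + 1)) ≤ _ from Ideal.span_mono ?_) heval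
    rintro y ⟨α, hα, rfl⟩
    exact ⟨α, by simp, hα, rfl⟩

/-- **Weighted quasi-regularity of a weakly regular sequence** in a Noetherian ring (globalised over
the maximal ideals containing `(f)` by `weightedQuasiRegular_of_localization`; at such an `𝔪` the
localised sequence is weakly regular, Mathlib `IsWeaklyRegular.of_isLocalization`, and lies in `𝔪 B_𝔪`).
[cite: Matsumura1987, Thm. 16.2] [cite: Wlodarczyk2022, §2.3.9] -/
theorem weightedQuasiRegular_of_isWeaklyRegular {B : Type u} [CommRing B] [IsNoetherianRing B]
    {k : ℕ} (f : Fin k → B) (w : Fin k → ℕ) (hw : ∀ i, 0 < w i)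
    (hreg : IsWeaklyRegular B (List.ofFn f))
    (n : ℕ) (P : MvPolynomial (Fin k) B) (hP : P.IsWeightedHomogeneous w n)
    (heval : MvPolynomial.eval f P ∈ (weightedFiltration f w).ideal (n + 1)) (β : Fin k →₀ ℕ) :
    P.coeff β ∈ Ideal.span (Set.range f) := by
  refine weightedQuasiRegular_of_localization f w (fun 𝔪 _ h𝔪 => ?_) n P hP heval β
  refine ⟨Localization.AtPrime 𝔪, inferInstance, inferInstance, inferInstance, ?_⟩
  have hx : IsWeaklyRegular (Localization.AtPrime 𝔪)
      (List.ofFn (algebraMap B (Localization.AtPrime 𝔪) ∘ f)) := by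
    have h := hreg.of_isLocalization (Localization.AtPrime 𝔪) 𝔪.primeCompl
    rwa [List.map_ofFn] at h
  have hm : ∀ i, (algebraMap B (Localization.AtPrime 𝔪) ∘ f) i ∈ maximalIdeal (Localization.AtPrime 𝔪) :=
    fun i => (IsLocalization.AtPrime.to_map_mem_maximal_iff (Localization.AtPrime 𝔪) 𝔪 (f i)).mpr
      (h𝔪 (Ideal.subset_span ⟨i, rfl⟩))
  exact weightedQuasiRegular_of_isWeaklyRegular_of_mem_maximalIdeal _ w hw hx hm

/-! ## H3a -/

/-- **H3a — the weighted extended Rees algebra `B[t⁻¹, f₁ t^{w₁}, …, f_c t^{w_c}]` of a weakly regular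
sequence `f` with REGULAR centre `B ⧸ (f)` in a regular ring `B`, positive weights, is Noetherian and
REGULAR** (Włodarczyk's full cobordant blow-up at a weighted centre; here from K1′ instead of a regular
system of parameters). [OURS · L1 W4.5c] [cite: Wlodarczyk2022, §2.3.9] [cite: Matsumura1987, Thm. 16.2] -/
theorem cobordantAlgebra_isRegularRing_of_isWeaklyRegular {B : Type u} [CommRing B] [IsRegularRing B]
    {k : ℕ} (f : Fin k → B) (w : Fin k → ℕ) (hw : ∀ i, 0 < w i)
    (hreg : IsWeaklyRegular B (List.ofFn f)) [IsRegularRing (B ⧸ Ideal.span (Set.range f))] :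
    IsNoetherianRing ↥(cobordantAlgebra f w) ∧ IsRegularRing ↥(cobordantAlgebra f w) :=
  ⟨cobordantAlgebra.isNoetherianRing f w,
    cobordantAlgebra.isRegularRing f w hw (weightedQuasiRegular_of_isWeaklyRegular f w hw hreg)⟩

/-- **The exceptional-fibre ring** (plan-1's `reesAlgebra_quotTInv_equiv_weightedGr`):
`B[t⁻¹, fᵢ t^{wᵢ}] ⧸ (t⁻¹) ≃ (B ⧸ (f))[X₁, …, X_c]`, the weighted associated graded ring, for a weakly
regular sequence `f` with positive weights in a Noetherian ring. [OURS · L1 W4.5c]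
[cite: Wlodarczyk2022, §2.3.9] [cite: Matsumura1987, Thm. 16.2] -/
theorem nonempty_cobordantAlgebra_quotient_s_equiv_of_isWeaklyRegular {B : Type u} [CommRing B]
    [IsNoetherianRing B] {k : ℕ} (f : Fin k → B) (w : Fin k → ℕ) (hw : ∀ i, 0 < w i)
    (hreg : IsWeaklyRegular B (List.ofFn f)) :
    Nonempty ((↥(cobordantAlgebra f w) ⧸ Ideal.span {cobordantAlgebra.s f w}) ≃+*
      MvPolynomial (Fin k) (B ⧸ Ideal.span (Set.range f))) :=
  cobordantAlgebra.nonempty_quotient_span_s_equiv f w hw (weightedQuasiRegular_of_isWeaklyRegular f w hw hreg)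

/-- **H3a, K1′ letters** (`RingTheory.Sequence.IsRegular B (List.ofFn f)` and `IsRegularRing (B ⧸ (f))`,
as typed in res-L1-w45c-idea-2's `OneNodeProducerStep`). [OURS · L1 W4.5c] [cite: Wlodarczyk2022, §2.3.9] -/
theorem cobordantAlgebra_isRegularRing_of_isRegular {B : Type u} [CommRing B] [IsRegularRing B]
    {k : ℕ} (f : Fin k → B) (w : Fin k → ℕ) (hw : ∀ i, 0 < w i)
    (hK1 : RingTheory.Sequence.IsRegular B (List.ofFn f))
    (hK1' : IsRegularRing (B ⧸ Ideal.span (Set.range f))) :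
    IsNoetherianRing ↥(cobordantAlgebra f w) ∧ IsRegularRing ↥(cobordantAlgebra f w) :=
  cobordantAlgebra_isRegularRing_of_isWeaklyRegular f w hw hK1.toIsWeaklyRegular

end Summit.ResolutionOfSingularities.ResolutionOfSingularities.Theorems.WildQuotientResolution.S1

end
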